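import Summits.QuantumFields.BalabanUV.T4Continuum.Support.SubstrateDrivenRecordSU

/-!
# SUBSTRATE — BACKGROUNDS AND THE DRIVEN OBJECT OF RECORD AT FINITE DEPTH: the background of record needs minimisers only up to the
# level it is read at (`K` for run A, `K + 1` for run B), so continuity of `M^k` ON the class is required only for `k ≤ K` resp.
# `k ≤ K + 1`, and the FINITE-DEPTH nested small-loop classes `NestedSmall ℰ δ′ K` ∕ `… (K+1)` carry the O-1 object at the `ℰ` of record

Cell `pub-balaban`, SUBSTRATE cell, seat `b2b-balaban-substrate-p2`; follower of `SubstrateDrivenRecordSU` (p220384) sharpening MAP v0.4 §O1 O-1 ∕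
D-3″ for consumers: `SubstrateBackground.backgroundOfRecordOn` and `SubstrateBlockAvgContinuity.drivenOfRecordSU` ask `∀ k` (all depths, also
beyond the tori), which forces the all-level class `nestedSmallAll`; Bałaban's small-field classes constrain finitely many levels.  Here the
`Setup.Background` data has domain `reachableUpTo … kmax` (empty above `kmax`), so the existence witness and the continuity `hiter` are needed
for `k ≤ kmax` only.  Edits nothing; all earlier objects stand.

HONEST FRAMING (T4-DAG p. 1).  Rung (B)+1 of the FINITE-VOLUME T⁴ continuum programme — NOT infinite volume, NOT a mass gap, NOT the
Clay problem, NOT summit progress, no estimate.  The inclusion of Bałaban's small-PLAQUETTE class of depth `K` in `NestedSmall ℰ δ′ K` is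
the one-step regularity ESTIMATE ([Balaban1985Averaging] Prop. 2) — displayed where consumed, never substrate.  HONEST DEPENDENCY (cell
line, verbatim): continuum YM on T⁴ ⇐ BetaPertH ∧ nine spine estimates (0/9 proved); BetaPertH ⇐ (D1) ∧ (D4) ∧ CAP+tail; G-an2-4 gates
asym, D1 and NE2/3/4.

* §1 `reachableUpTo av reg kmax k`; **`backgroundOfRecordOneUpTo`** (minimiser chosen for `k ≤ kmax`, `1` over `V = M^k 1`, junk above `kmax`
  with EMPTY domain there), `_reg ∕ _dom ∕ _U_iter_one ∕ _U_one`; `forall_upTo_exists_isBackground_of_continuousOn`;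
  **`backgroundOfRecordCompactOneUpTo`** (`hiter : ∀ k ≤ kmax, ContinuousOn (M^k) reg`).
* §2 **`drivenOfRecordUpTo`** = `DrivenRuns.balaban` with depth `K` (run A) and `K + 1` (run B); `mem_domV_…_iff`, `one_mem_domV_…`,
  `uA_one ∕ uB_one_…` under `ℰ.E (1,…,1) = 1`.
* §3 `nestedSmall_mono`; **`drivenRecordSUUpTo F K m′ gA gB : DrivenRuns SU(n)`** on the FINITE-DEPTH classes `NestedSmall expMeanLogSU (δ_SU/2) K`
  and `… (K+1)` of the two tori — hypothesis-free, with `one_mem_domV ∕ uA_one ∕ uB_one_drivenRecordSUUpTo`.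
No estimate, no `def … : Prop`, no `sorry`.
-/

noncomputable section

open scoped BigOperators Topology

namespace Summit.QuantumFields.BalabanUV.T4Continuum.SubstrateBackgroundUpTo

open Literature.MathematicalPhysics.QuantumFieldTheory.Balaban1983to89
open Literature.MathematicalPhysics.QuantumFieldTheory.Balaban1983to89.T4Continuum (T4Family)
open Summit.QuantumFields.BalabanUV.T4Continuum.SubstrateBackground
open Summit.QuantumFields.BalabanUV.T4Continuum.SubstrateTwoRunsDriven
open Summit.QuantumFields.BalabanUV.T4Continuum.SubstrateBackgroundDriven
open Summit.QuantumFields.BalabanUV.T4Continuum.SubstrateBlockAvgContinuity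

variable {P : Params} {G : Type*} [GaugeGroup G]

/-! ## §1 Backgrounds of record at finite depth -/

/-- [folklore] THE REACHABLE SET UP TO DEPTH `kmax`: reachable level-`k` fields for `k ≤ kmax`, nothing above. -/
def reachableUpTo (av : ∀ j, Averaging P j G) (reg : Set (GaugeField P 0 G)) (kmax k : ℕ) : Set (GaugeField P k G) :=
  {V | k ≤ kmax ∧ V ∈ reachable av reg k}

/-- [folklore] Membership. -/
theorem mem_reachableUpTo {av : ∀ j, Averaging P j G} {reg : Set (GaugeField P 0 G)} {kmax k : ℕ} {V : GaugeField P k G} :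
    V ∈ reachableUpTo av reg kmax k ↔ k ≤ kmax ∧ V ∈ reachable av reg k :=
  Iff.rfl

open Classical in
/-- [folklore] **THE NORMALISED BACKGROUND OF RECORD AT FINITE DEPTH**: for `k ≤ kmax` and `V` reachable the chosen constrained minimiser
(from the witness `h`), `1` over every `V = M^k 1` (legitimate: `isBackground_one`), junk `1` elsewhere — with domain `reachableUpTo`, so
no obligation above `kmax`. -/
def backgroundOfRecordOneUpTo (av : ∀ j, Averaging P j G) (reg : Set (GaugeField P 0 G)) (kmax : ℕ)
    (h : ∀ k, k ≤ kmax → ∀ V : GaugeField P k G, V ∈ reachable av reg k → ∃ U₀, IsBackground av reg k V U₀)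
    (h1 : (1 : GaugeField P 0 G) ∈ reg) : Background P G av where
  reg := reg
  dom := reachableUpTo av reg kmax
  U := fun k V => if V = Averaging.iter av k 1 then 1
    else if hV : k ≤ kmax ∧ V ∈ reachable av reg k then (h k hV.1 V hV.2).choose else 1
  isBackground := fun k V hV => by
    by_cases hV1 : V = Averaging.iter av k 1
    · simp only [hV1, if_true]
      exact isBackground_one av h1 k
    · have hV' : k ≤ kmax ∧ V ∈ reachable av reg k := hV
      simp only [hV1, if_false, dif_pos hV']
      exact (h k hV'.1 V hV'.2).choose_spec

/-- [folklore] Its class (`rfl`). -/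
@[simp] theorem backgroundOfRecordOneUpTo_reg (av : ∀ j, Averaging P j G) (reg : Set (GaugeField P 0 G)) (kmax : ℕ)
    (h : ∀ k, k ≤ kmax → ∀ V : GaugeField P k G, V ∈ reachable av reg k → ∃ U₀, IsBackground av reg k V U₀)
    (h1 : (1 : GaugeField P 0 G) ∈ reg) : (backgroundOfRecordOneUpTo av reg kmax h h1).reg = reg := rfl

/-- [folklore] Its domain (`rfl`). -/
@[simp] theorem backgroundOfRecordOneUpTo_dom (av : ∀ j, Averaging P j G) (reg : Set (GaugeField P 0 G)) (kmax : ℕ)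
    (h : ∀ k, k ≤ kmax → ∀ V : GaugeField P k G, V ∈ reachable av reg k → ∃ U₀, IsBackground av reg k V U₀)
    (h1 : (1 : GaugeField P 0 G) ∈ reg) (k : ℕ) : (backgroundOfRecordOneUpTo av reg kmax h h1).dom k = reachableUpTo av reg kmax k := rfl

/-- [folklore] **The background over `M^k 1` is `1`.** -/
theorem backgroundOfRecordOneUpTo_U_iter_one (av : ∀ j, Averaging P j G) (reg : Set (GaugeField P 0 G)) (kmax : ℕ)
    (h : ∀ k, k ≤ kmax → ∀ V : GaugeField P k G, V ∈ reachable av reg k → ∃ U₀, IsBackground av reg k V U₀)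
    (h1 : (1 : GaugeField P 0 G) ∈ reg) (k : ℕ) :
    (backgroundOfRecordOneUpTo av reg kmax h h1).U k (Averaging.iter av k 1) = 1 := by
  classical
  show (if Averaging.iter av k (1 : GaugeField P 0 G) = Averaging.iter av k 1 then (1 : GaugeField P 0 G) else _) = 1
  rw [if_pos rfl]

/-- [folklore] For averagings fixing `1`, the background over the trivial level-`k` field is `1`. -/
theorem backgroundOfRecordOneUpTo_U_one (av : ∀ j, Averaging P j G) (hav1 : ∀ j, (av j).avg 1 = 1) (reg : Set (GaugeField P 0 G))
    (kmax : ℕ) (h : ∀ k, k ≤ kmax → ∀ V : GaugeField P k G, V ∈ reachable av reg k → ∃ U₀, IsBackground av reg k V U₀)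
    (h1 : (1 : GaugeField P 0 G) ∈ reg) (k : ℕ) : (backgroundOfRecordOneUpTo av reg kmax h h1).U k 1 = 1 := by
  have e := backgroundOfRecordOneUpTo_U_iter_one av reg kmax h h1 k
  rwa [iter_one av hav1 k] at e

section Compact

variable [TopologicalSpace G] [IsTopologicalGroup G] [CompactSpace G] [T2Space G]

/-- [folklore] Existence of constrained minimisers at every depth `≤ kmax` from continuity of `M^k` ON the class for `k ≤ kmax` only
(`SubstrateBackground.exists_isBackground_of_continuousOn` levelwise). -/
theorem forall_upTo_exists_isBackground_of_continuousOn (hreTr : Continuous (reTr : G → ℝ)) (av : ∀ j, Averaging P j G)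
    {reg : Set (GaugeField P 0 G)} (hreg : IsClosed reg) {kmax : ℕ} (hiter : ∀ k, k ≤ kmax → ContinuousOn (Averaging.iter av k) reg) :
    ∀ k, k ≤ kmax → ∀ V : GaugeField P k G, V ∈ reachable av reg k → ∃ U₀, IsBackground av reg k V U₀ :=
  fun k hk _ hV => exists_isBackground_of_continuousOn hreTr av hreg (hiter k hk) hV

/-- [folklore] **THE NORMALISED BACKGROUND OF RECORD AT FINITE DEPTH FROM COMPACTNESS** (`hiter` for `k ≤ kmax` only). -/
def backgroundOfRecordCompactOneUpTo (hreTr : Continuous (reTr : G → ℝ)) (av : ∀ j, Averaging P j G) (reg : Set (GaugeField P 0 G))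
    (hreg : IsClosed reg) (kmax : ℕ) (hiter : ∀ k, k ≤ kmax → ContinuousOn (Averaging.iter av k) reg) (h1 : (1 : GaugeField P 0 G) ∈ reg) :
    Background P G av :=
  backgroundOfRecordOneUpTo av reg kmax (forall_upTo_exists_isBackground_of_continuousOn hreTr av hreg hiter) h1

/-- [folklore] Its domain (`rfl`). -/
@[simp] theorem backgroundOfRecordCompactOneUpTo_dom (hreTr : Continuous (reTr : G → ℝ)) (av : ∀ j, Averaging P j G)
    (reg : Set (GaugeField P 0 G)) (hreg : IsClosed reg) (kmax : ℕ) (hiter : ∀ k, k ≤ kmax → ContinuousOn (Averaging.iter av k) reg)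
    (h1 : (1 : GaugeField P 0 G) ∈ reg) (k : ℕ) :
    (backgroundOfRecordCompactOneUpTo hreTr av reg hreg kmax hiter h1).dom k = reachableUpTo av reg kmax k := rfl

end Compact

/-! ## §2 The driven two-run object of record at finite depth -/

section Driven

variable {G : Type} [GaugeGroup G] [TopologicalSpace G] [IsTopologicalGroup G] [CompactSpace G] [T2Space G]

/-- [folklore] **THE DRIVEN TWO-RUN OBJECT OF RECORD AT FINITE DEPTH**: `DrivenRuns.balaban` with run A's background of depth `K` on
`F.P K` and run B's of depth `K + 1` on `F.P (K+1)`; continuity of `M^k` on the classes for `k ≤ K` resp. `k ≤ K + 1` only. -/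
def drivenOfRecordUpTo (hreTr : Continuous (reTr : G → ℝ)) (F : T4Family) (K m' : ℕ) (ℰ : LoopAverage G)
    (regA : Set (GaugeField (F.P K) 0 G)) (hregA : IsClosed regA) (h1A : (1 : GaugeField (F.P K) 0 G) ∈ regA)
    (hiterA : ∀ k, k ≤ K → ContinuousOn (Averaging.iter (fun j => BlockAveraging.blockAvg (P := F.P K) (j := j) ℰ) k) regA)
    (regB : Set (GaugeField (F.P (K + 1)) 0 G)) (hregB : IsClosed regB) (h1B : (1 : GaugeField (F.P (K + 1)) 0 G) ∈ regB)
    (hiterB : ∀ k, k ≤ K + 1 → ContinuousOn (Averaging.iter (fun j => BlockAveraging.blockAvg (P := F.P (K + 1)) (j := j) ℰ) k) regB)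
    (gA gB : ℕ → ℝ) : DrivenRuns G :=
  DrivenRuns.balaban F K m' ℰ
    (backgroundOfRecordCompactOneUpTo hreTr (fun j => BlockAveraging.blockAvg (j := j) ℰ) regA hregA K hiterA h1A)
    (backgroundOfRecordCompactOneUpTo hreTr (fun j => BlockAveraging.blockAvg (j := j) ℰ) regB hregB (K + 1) hiterB h1B) gA gB

variable (hreTr : Continuous (reTr : G → ℝ)) (F : T4Family) (K m' : ℕ) (ℰ : LoopAverage G)
  (regA : Set (GaugeField (F.P K) 0 G)) (hregA : IsClosed regA) (h1A : (1 : GaugeField (F.P K) 0 G) ∈ regA)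
  (hiterA : ∀ k, k ≤ K → ContinuousOn (Averaging.iter (fun j => BlockAveraging.blockAvg (P := F.P K) (j := j) ℰ) k) regA)
  (regB : Set (GaugeField (F.P (K + 1)) 0 G)) (hregB : IsClosed regB) (h1B : (1 : GaugeField (F.P (K + 1)) 0 G) ∈ regB)
  (hiterB : ∀ k, k ≤ K + 1 → ContinuousOn (Averaging.iter (fun j => BlockAveraging.blockAvg (P := F.P (K + 1)) (j := j) ℰ) k) regB)
  (gA gB : ℕ → ℝ)

/-- [folklore] Its carriers are the unrestricted carriers of record with Bałaban's averaging as the transport. -/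
theorem drivenOfRecordUpTo_toTwoRuns :
    (drivenOfRecordUpTo hreTr F K m' ℰ regA hregA h1A hiterA regB hregB h1B hiterB gA gB).toTwoRuns =
      B13Carriers.TwoRuns.univ F K m' (BlockAveraging.blockAvg ℰ) :=
  DrivenRuns.balaban_toTwoRuns F K m' ℰ _ _ gA gB

/-- [folklore] **ITS DRIVING DOMAIN**: unit fields whose top copies are reachable in both runs (the depth conditions `K ≤ K`, `K+1 ≤ K+1`
are automatic). -/
theorem mem_domV_drivenOfRecordUpTo_iff (V : UnitField F G) :
    V ∈ (drivenOfRecordUpTo hreTr F K m' ℰ regA hregA h1A hiterA regB hregB h1B hiterB gA gB).domV ↔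
      (K ≤ K ∧ atTop K V ∈ reachable (fun j => BlockAveraging.blockAvg (j := j) ℰ) regA K) ∧
        (K + 1 ≤ K + 1 ∧ atTop (K + 1) V ∈ reachable (fun j => BlockAveraging.blockAvg (j := j) ℰ) regB (K + 1)) :=
  Iff.rfl

/-- [folklore] **`1 ∈ domV`** for `ℰ` normalised at identity families. -/
theorem one_mem_domV_drivenOfRecordUpTo (hE : ∀ m : ℕ, ℰ.E (fun _ : Fin (m + 1) => (1 : G)) = 1) :
    (1 : UnitField F G) ∈ (drivenOfRecordUpTo hreTr F K m' ℰ regA hregA h1A hiterA regB hregB h1B hiterB gA gB).domV := by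
  rw [mem_domV_drivenOfRecordUpTo_iff, atTop_one, atTop_one]
  refine ⟨⟨le_rfl, ?_⟩, ⟨le_rfl, ?_⟩⟩
  · have e := iter_one (fun j => BlockAveraging.blockAvg (P := F.P K) (j := j) ℰ) (fun _ => blockAvg_one_of_E_one ℰ hE) K
    rw [← e]
    exact iter_one_mem_reachable _ h1A K
  · have e := iter_one (fun j => BlockAveraging.blockAvg (P := F.P (K + 1)) (j := j) ℰ) (fun _ => blockAvg_one_of_E_one ℰ hE) (K + 1)
    rw [← e]
    exact iter_one_mem_reachable _ h1B (K + 1)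

/-- [folklore] **`oneA`** at finite depth. -/
theorem uA_one_drivenOfRecordUpTo (hE : ∀ m : ℕ, ℰ.E (fun _ : Fin (m + 1) => (1 : G)) = 1) :
    ((drivenOfRecordUpTo hreTr F K m' ℰ regA hregA h1A hiterA regB hregB h1B hiterB gA gB).uA
        ⟨1, one_mem_domV_drivenOfRecordUpTo hreTr F K m' ℰ regA hregA h1A hiterA regB hregB h1B hiterB gA gB hE⟩).1 = 1 := by
  show (backgroundOfRecordCompactOneUpTo hreTr (fun j => BlockAveraging.blockAvg (j := j) ℰ) regA hregA K hiterA h1A).U K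
      (atTop K (1 : UnitField F G)) = 1
  rw [atTop_one]
  exact backgroundOfRecordOneUpTo_U_one _ (fun _ => blockAvg_one_of_E_one ℰ hE) regA K _ h1A K

/-- [folklore] **`oneB`** at finite depth. -/
theorem uB_one_drivenOfRecordUpTo (hE : ∀ m : ℕ, ℰ.E (fun _ : Fin (m + 1) => (1 : G)) = 1) :
    ((drivenOfRecordUpTo hreTr F K m' ℰ regA hregA h1A hiterA regB hregB h1B hiterB gA gB).uB
        ⟨1, one_mem_domV_drivenOfRecordUpTo hreTr F K m' ℰ regA hregA h1A hiterA regB hregB h1B hiterB gA gB hE⟩).1 = 1 := by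
  show (backgroundOfRecordCompactOneUpTo hreTr (fun j => BlockAveraging.blockAvg (j := j) ℰ) regB hregB (K + 1) hiterB h1B).U (K + 1)
      (atTop (K + 1) (1 : UnitField F G)) = 1
  rw [atTop_one]
  exact backgroundOfRecordOneUpTo_U_one _ (fun _ => blockAvg_one_of_E_one ℰ hE) regB (K + 1) _ h1B (K + 1)

end Driven

/-! ## §3 The object of record on `SU(n)` on the FINITE-DEPTH nested small-loop classes -/

/-- [folklore] The nested classes decrease with the depth. -/
theorem nestedSmall_mono (ℰ : LoopAverage G) (δ' : ℝ) {k k' : ℕ} (h : k ≤ k') : NestedSmall (P := P) ℰ δ' k' ⊆ NestedSmall ℰ δ' k :=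
  fun _ hU i hi => hU i (lt_of_lt_of_le hi h)

section SU

open ExpMeanLog

variable {n : Type} [Fintype n] [DecidableEq n] [Nonempty n]

/-- [folklore] **THE DRIVEN TWO-RUN OBJECT OF RECORD AT `ℰ = expMeanLogSU` ON THE FINITE-DEPTH CLASSES** `NestedSmall expMeanLogSU (δ_SU/2) K`
(torus `F.P K`) and `… (K + 1)` (torus `F.P (K+1)`) — closed, `∋ 1`, and carrying the continuity of `M^k` for `k ≤` depth
(`continuousOn_iter_blockAvg` + `nestedSmall_mono`); hypothesis-free. -/
def drivenRecordSUUpTo (F : T4Family) (K m' : ℕ) (gA gB : ℕ → ℝ) : DrivenRuns (Matrix.specialUnitaryGroup n ℂ) :=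
  drivenOfRecordUpTo continuous_reTr_specialUnitaryGroup F K m' expMeanLogSU
    (NestedSmall expMeanLogSU ((expMeanLogSU (n := n)).δ / 2) K)
    (isClosed_nestedSmall _ continuous_dist1_SU smallContinuous_expMeanLogSU half_deltaSU_lt K)
    (one_mem_nestedSmall _ (fun _ => ESU_const_one) half_deltaSU_nonneg K)
    (fun k hk => (continuousOn_iter_blockAvg _ continuous_dist1_SU smallContinuous_expMeanLogSU half_deltaSU_lt k).mono
      (nestedSmall_mono _ _ hk))
    (NestedSmall expMeanLogSU ((expMeanLogSU (n := n)).δ / 2) (K + 1))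
    (isClosed_nestedSmall _ continuous_dist1_SU smallContinuous_expMeanLogSU half_deltaSU_lt (K + 1))
    (one_mem_nestedSmall _ (fun _ => ESU_const_one) half_deltaSU_nonneg (K + 1))
    (fun k hk => (continuousOn_iter_blockAvg _ continuous_dist1_SU smallContinuous_expMeanLogSU half_deltaSU_lt k).mono
      (nestedSmall_mono _ _ hk))
    gA gB

/-- [folklore] **`1 ∈ domV`, HYPOTHESIS-FREE**, at finite depth. -/
theorem one_mem_domV_drivenRecordSUUpTo (F : T4Family) (K m' : ℕ) (gA gB : ℕ → ℝ) :
    (1 : UnitField F (Matrix.specialUnitaryGroup n ℂ)) ∈ (drivenRecordSUUpTo (n := n) F K m' gA gB).domV :=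
  one_mem_domV_drivenOfRecordUpTo _ F K m' _ _ _ _ _ _ _ _ _ gA gB fun _ => ESU_const_one

/-- [folklore] **`oneA`, HYPOTHESIS-FREE**, at finite depth. -/
theorem uA_one_drivenRecordSUUpTo (F : T4Family) (K m' : ℕ) (gA gB : ℕ → ℝ) :
    ((drivenRecordSUUpTo (n := n) F K m' gA gB).uA ⟨1, one_mem_domV_drivenRecordSUUpTo F K m' gA gB⟩).1 = 1 :=
  uA_one_drivenOfRecordUpTo _ F K m' _ _ _ _ _ _ _ _ _ gA gB fun _ => ESU_const_one

/-- [folklore] **`oneB`, HYPOTHESIS-FREE**, at finite depth. -/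
theorem uB_one_drivenRecordSUUpTo (F : T4Family) (K m' : ℕ) (gA gB : ℕ → ℝ) :
    ((drivenRecordSUUpTo (n := n) F K m' gA gB).uB ⟨1, one_mem_domV_drivenRecordSUUpTo F K m' gA gB⟩).1 = 1 :=
  uB_one_drivenOfRecordUpTo _ F K m' _ _ _ _ _ _ _ _ _ gA gB fun _ => ESU_const_one

end SU

end Summit.QuantumFields.BalabanUV.T4Continuum.SubstrateBackgroundUpTo

end
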